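import Summits.RiemannHypothesis.RiemannHypothesis.Theorems.SemilocalNegTerms
import Summits.RiemannHypothesis.RiemannHypothesis.Theorems.SemilocalArchTail
import Summits.RiemannHypothesis.RiemannHypothesis.Theorems.SemilocalThresholdCertificateBridge
import Summits.RiemannHypothesis.RiemannHypothesis.Theorems.SemilocalTwoConstantSharp
import HarnessLib

/-!
# Semi-local threshold, negative side — the CERTIFICATE `WeilNegCert2`, its checker, and soundness

Cell `rh-explicit` (HOME `run/shared/lean/pub/rh-explicit/`), seat cc-s2-4 (`HOME/cc-s2-4/CC4-THRESHOLD-PLAN.md` §2).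
Honest framing: a theorem about the tree's `weilSemilocalThreshold {2}` (consolation-prize side of the motivic door);
nothing here bears on RH.  No data is trusted: the soundness theorem consumes only `c.check c₂ = true`.

A certificate is `(p, b; nA, mA, KA; Kt, nt; ne)`: an odd polynomial `p ∈ ℚ[x]` (the witness `G = p·1_{[−b,b]}`),
the window `b ∈ ℚ`, and the orders of the three rational enclosures (archimedean majorant, tail, polar moment).
`check c c₂` (pure `ℚ`/`Bool`, `decide`-able) verifies the side conditions and the STRICT INEQUALITY

  `(L⁺/s)·U_{log 2} + A + 2N·T < c₂·N + 2·m²`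

where `U_{log 2} ≥ D(log 2)` (`evalUpperQ` at the 20-digit enclosure of `log 2`), `A ≥ ∫₀^{2b} w·D` (THEOREM B,
`archMajorL`), `T ≥ ∫_{2b}^∞ w` (`archTailQ`), `N = ‖G‖²` (`normSq`), `m ≤ |Ĝ(1)|` (`mellinOneLowerQ`), `L⁺ ≥ log 2`,
`s ≤ √2`, and `c₂` is ANY proved rational lower bound of `C₂ = semilocalTwoConstant` (the sharp one is `c2SharpQ`,
`SemilocalTwoConstantSharp.lean`, from the closed form `C₂ = (1+√2) log 2 + log 4π + γ + π/2`, error `2.3·10⁻¹⁶`).  SOUNDNESS (`weilSemilocalThreshold_two_le_of_check`):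
`check c c₂ = true → c₂ ≤ C₂ → a*({2}) ≤ c.b`, through lad-2's polar-credit criterion and the bridge (B−).
-/

set_option linter.dupNamespace false  -- the mandated namespace repeats `RiemannHypothesis`

noncomputable section

open MeasureTheory Set Finset Real
open Literature.NumberTheory.LFunctions
open Summit.RiemannHypothesis.RiemannHypothesis.Theorems.MotivicDoor
open Summit.RiemannHypothesis.RiemannHypothesis.Theorems.MotivicDoor.SemilocalThreshold

namespace Summit.RiemannHypothesis.RiemannHypothesis.Theorems.SemilocalPolyWitness

open LQ

/-! ## Constants -/

/-- `0.69314718055994530940 ≤ log 2` (20 digits, `LogTwoBounds`). -/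
def logTwoLo20 : ℚ := 69314718055994530940 / 100000000000000000000

/-- `log 2 ≤ 0.69314718055994530944`. -/
def logTwoHi20 : ℚ := 69314718055994530944 / 100000000000000000000

/-- `logTwoLo20 ≤ log 2`. -/
theorem logTwoLo20_le : (logTwoLo20 : ℝ) ≤ Real.log 2 := by
  have h := Literature.Analysis.SpecialFunctions.Real.log_two_gt_d20
  rw [logTwoLo20]; push_cast; linarith

/-- `log 2 ≤ logTwoHi20`. -/
theorem log_two_le_logTwoHi20 : Real.log 2 ≤ (logTwoHi20 : ℝ) := by
  have h := Literature.Analysis.SpecialFunctions.Real.log_two_lt_d20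
  rw [logTwoHi20]; push_cast; linarith

/-- `1.4142135623730950488 ≤ √2`. -/
def sqrtTwoLo : ℚ := 14142135623730950488 / 10000000000000000000

/-- `0 < sqrtTwoLo`. -/
theorem sqrtTwoLo_pos : (0 : ℝ) < sqrtTwoLo := by rw [sqrtTwoLo]; norm_num

/-- `sqrtTwoLo ≤ √2`. -/
theorem sqrtTwoLo_le : (sqrtTwoLo : ℝ) ≤ Real.sqrt 2 := by
  rw [show (sqrtTwoLo : ℝ) = Real.sqrt ((sqrtTwoLo : ℝ) ^ 2) from (Real.sqrt_sq sqrtTwoLo_pos.le).symm]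
  exact Real.sqrt_le_sqrt (by rw [sqrtTwoLo]; norm_num)

/-! ## The certificate -/

/-- A negative certificate for the `{∞,2}` threshold: an odd polynomial witness and enclosure orders. -/
structure WeilNegCert2 where
  /-- coefficients (in powers of `x`) of the odd polynomial `p`; the witness is `p·1_{[−b,b]}` -/
  p : List ℚ
  /-- the window half-width (`a*({2}) ≤ b` is the conclusion) -/
  b : ℚ
  /-- order of the `exp` majorant in `archMajorL` (`≥ 1`) -/
  nA : ℕ
  /-- half the number of geometric terms in `archMajorL` -/
  mA : ℕ
  /-- order of the `sinh` minorant in `archMajorL` -/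
  KA : ℕ
  /-- number of explicit tail exponentials -/
  Kt : ℕ
  /-- order of the partial `exp` sums bounding `e^{−x}` (`≥ 1`) -/
  nt : ℕ
  /-- order of the Maclaurin polynomial in the polar moment (`≥ 1`) -/
  ne : ℕ

namespace WeilNegCert2

variable (c : WeilNegCert2)

/-- `q = D/t` as a list (the increment list without its vanishing constant coefficient). -/
def q : List ℚ := (incrementL c.p c.b).tail

/-- Upper bound of the left side `(log 2/√2)·D(log 2) + ∫₀^∞ w·D`. -/
def lhsQ : ℚ :=
  logTwoHi20 / sqrtTwoLo * evalUpperQ (incrementL c.p c.b) logTwoLo20 (logTwoHi20 - logTwoLo20)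
    + evQ (integ (mul (archMajorL c.nA c.mA c.KA) c.q)) (2 * c.b)
    + 2 * LQ.normSq c.p c.b * archTailQ (2 * c.b) c.Kt c.nt

/-- Lower bound of the right side `C₂‖G‖² + 2|Ĝ(1)|²`, given a lower bound `c₂ ≤ C₂`. -/
def rhsQ (c2 : ℚ) : ℚ := c2 * LQ.normSq c.p c.b + 2 * mellinOneLowerQ c.p c.b c.ne ^ 2

/-- **The checker.** -/
def check (c2 : ℚ) : Bool :=
  isOddList c.p && decide (0 < c.b) && decide (c.b ≤ 1) && decide (c.b < logTwoLo20) &&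
    decide (logTwoHi20 ≤ 2 * c.b) && decide (0 < c.nA) && decide (0 < c.nt) && decide (0 < c.ne) &&
    decide ((incrementL c.p c.b).headD 0 = 0) && decide (invPartialExpQ c.nt (2 * (2 * c.b)) < 1) &&
    decide (0 ≤ c2) && decide (c.lhsQ < c.rhsQ c2)

end WeilNegCert2

/-! ## Soundness -/

/-- `ev l t = l.headD 0 + t · ev l.tail t`. -/
theorem ev_eq_headD_add_tail (l : List ℚ) (t : ℝ) : ev l t = (l.headD 0 : ℝ) + t * ev l.tail t := by
  cases l with
  | nil => simp
  | cons a as => simp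

/-- **SOUNDNESS of `WeilNegCert2`.**  If the checker accepts `c` against a proved lower bound `c₂ ≤ C₂`, then the
`{∞,2}`-threshold satisfies `a*({2}) ≤ c.b`. -/
theorem weilSemilocalThreshold_two_le_of_check (c : WeilNegCert2) {c2 : ℚ}
    (hc2 : (c2 : ℝ) ≤ SemilocalMarkov.semilocalTwoConstant) (h : c.check c2 = true) :
    weilSemilocalThreshold {2} ≤ (c.b : ℝ) := by
  -- unpack the checker
  simp only [WeilNegCert2.check, Bool.and_eq_true, decide_eq_true_eq] at h
  obtain ⟨⟨⟨⟨⟨⟨⟨⟨⟨⟨⟨hodd, hb0⟩, hb1⟩, hblog⟩, h2b⟩, hnA⟩, hnt⟩, hne⟩, hhead⟩, htail1⟩, hc20⟩, hmain⟩ := h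
  set p := c.p
  set b := c.b
  have hb0' : (0 : ℝ) < b := by exact_mod_cast hb0
  have hb2' : ((2 * b : ℚ) : ℝ) ≤ 2 := by
    have h2 : 2 * b ≤ (2 : ℚ) := by linarith
    exact_mod_cast h2
  have hblt : (b : ℝ) < Real.log 2 := lt_of_lt_of_le (by exact_mod_cast hblog) logTwoLo20_le
  set G := polyWitness p b with hG
  have hW := isMarkovWitness_polyWitness (p := p) (b := b) hodd hb0
  set inc := incrementL p b
  set N : ℝ := (LQ.normSq p b : ℝ)
  have hN : ∫ x, ‖G x‖ ^ 2 = N := integral_norm_sq_polyWitness (p := p) hb0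
  have hN0 : 0 ≤ N := by rw [← hN]; exact integral_nonneg fun x ↦ by positivity
  -- D on (0, 2b]: D(t) = ev inc t = t · ev q t, q ≥ 0
  have hDev : ∀ t ∈ Set.Ioc (0 : ℝ) ((2 * b : ℚ) : ℝ), weilIncrement G t = ev inc t := fun t ht ↦
    weilIncrement_polyWitness_eq_ev hodd hb0 ht.1.le (by push_cast at ht; exact ht.2)
  have hDq : ∀ t ∈ Set.Ioc (0 : ℝ) ((2 * b : ℚ) : ℝ), weilIncrement G t = t * ev c.q t := fun t ht ↦ by
    rw [hDev t ht, ev_eq_headD_add_tail, hhead]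
    push_cast
    rw [zero_add]
    rfl
  have hq : ∀ t ∈ Set.Ioc (0 : ℝ) ((2 * b : ℚ) : ℝ), 0 ≤ ev c.q t := fun t ht ↦ by
    have h1 := weilIncrement_nonneg G t
    rw [hDq t ht] at h1
    exact (mul_nonneg_iff_of_pos_left ht.1).1 h1
  -- bulk
  obtain ⟨hintA, hA⟩ := setIntegral_weilArchDensity_mul_le (D := weilIncrement G) (by positivity) hb2' hDq hq
    c.nA c.mA c.KA hnA
  -- tail
  have h2b0 : (0 : ℚ) < 2 * b := by positivity
  obtain ⟨hintW, _⟩ := setIntegral_Ioi_weilArchDensity_le c.Kt (c := ((2 * b : ℚ) : ℝ)) (by exact_mod_cast h2b0)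
  have hT := setIntegral_Ioi_weilArchDensity_le_archTailQ c.Kt hnt h2b0 htail1
  have hDtail : EqOn (fun t ↦ weilArchDensity t * weilIncrement G t) (fun t ↦ 2 * N * weilArchDensity t)
      (Set.Ioi ((2 * b : ℚ) : ℝ)) := fun t ht ↦ by
    simp only
    rw [weilIncrement_polyWitness_eq_of_lt hodd hb0 (by push_cast at ht; exact ht)]
    ring
  have hintW' : IntegrableOn (fun t ↦ 2 * N * weilArchDensity t) (Set.Ioi ((2 * b : ℚ) : ℝ)) :=
    hintW.const_mul (2 * N)
  have hintT : IntegrableOn (fun t ↦ weilArchDensity t * weilIncrement G t) (Set.Ioi ((2 * b : ℚ) : ℝ)) :=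
    hintW'.congr_fun hDtail.symm measurableSet_Ioi
  have hTail : ∫ t in Set.Ioi ((2 * b : ℚ) : ℝ), weilArchDensity t * weilIncrement G t ≤ 2 * N * archTailQ (2 * b) c.Kt c.nt := by
    rw [setIntegral_congr_fun measurableSet_Ioi hDtail, integral_const_mul]
    exact mul_le_mul_of_nonneg_left hT (by positivity)
  -- the whole half-line
  have hunion : Set.Ioc (0 : ℝ) ((2 * b : ℚ) : ℝ) ∪ Set.Ioi ((2 * b : ℚ) : ℝ) = Set.Ioi (0 : ℝ) :=
    Set.Ioc_union_Ioi_eq_Ioi (by exact_mod_cast h2b0.le)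
  have hfin : IntegrableOn (fun t ↦ weilArchDensity t * weilIncrement G t) (Set.Ioi (0 : ℝ)) := by
    rw [← hunion]; exact hintA.union hintT
  have hInt : ∫ t in Set.Ioi (0 : ℝ), weilArchDensity t * weilIncrement G t
      ≤ (evQ (integ (mul (archMajorL c.nA c.mA c.KA) c.q)) (2 * b) : ℝ) + 2 * N * archTailQ (2 * b) c.Kt c.nt := by
    rw [← hunion, setIntegral_union Ioc_disjoint_Ioi_same measurableSet_Ioi hintA hintT]
    exact add_le_add hA hTail
  -- the value at log 2
  have hlog2mem : Real.log 2 ∈ Set.Ioc (0 : ℝ) ((2 * b : ℚ) : ℝ) :=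
    ⟨Real.log_pos one_lt_two, by
      have h2b' : ((logTwoHi20 : ℚ) : ℝ) ≤ ((2 * b : ℚ) : ℝ) := by exact_mod_cast h2b
      exact log_two_le_logTwoHi20.trans h2b'⟩
  have hDlog : weilIncrement G (Real.log 2) ≤ (evalUpperQ inc logTwoLo20 (logTwoHi20 - logTwoLo20) : ℝ) := by
    rw [hDev _ hlog2mem]
    exact ev_le_evalUpperQ inc logTwoLo20_le (by push_cast; linarith [log_two_le_logTwoHi20])
  have hDlog0 : 0 ≤ weilIncrement G (Real.log 2) := weilIncrement_nonneg G _
  have hcoef : Real.log 2 / Real.sqrt 2 ≤ (logTwoHi20 : ℝ) / sqrtTwoLo :=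
    div_le_div₀ (by rw [logTwoHi20]; norm_num) log_two_le_logTwoHi20 sqrtTwoLo_pos sqrtTwoLo_le
  have hcoef0 : 0 ≤ Real.log 2 / Real.sqrt 2 := by positivity
  have hL : Real.log 2 / Real.sqrt 2 * weilIncrement G (Real.log 2)
      ≤ (logTwoHi20 : ℝ) / sqrtTwoLo * evalUpperQ inc logTwoLo20 (logTwoHi20 - logTwoLo20) :=
    mul_le_mul hcoef hDlog hDlog0 (hcoef0.trans hcoef)
  -- the polar moment
  have hm := mellinOneLowerQ_le_norm (p := p) hne hb0 (by exact_mod_cast hb1.trans (by norm_num : (1:ℚ) ≤ 2))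
  have hm0 : (0 : ℝ) ≤ mellinOneLowerQ p b c.ne := by rw [mellinOneLowerQ]; push_cast; exact le_max_right _ _
  have hpol : (mellinOneLowerQ p b c.ne : ℝ) ^ 2 ≤ ‖weilMellin G 1‖ ^ 2 := pow_le_pow_left₀ hm0 hm 2
  -- assemble the strict inequality
  have hmain' : (c.lhsQ : ℝ) < c.rhsQ c2 := by exact_mod_cast hmain
  have hlhs : Real.log 2 / Real.sqrt 2 * weilIncrement G (Real.log 2)
      + ∫ t in Set.Ioi (0 : ℝ), weilArchDensity t * weilIncrement G t ≤ (c.lhsQ : ℝ) := by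
    rw [WeilNegCert2.lhsQ]; push_cast; linarith
  have hrhs : (c.rhsQ c2 : ℝ) ≤ SemilocalMarkov.semilocalTwoConstant * (∫ x, ‖G x‖ ^ 2) + 2 * ‖weilMellin G 1‖ ^ 2 := by
    rw [WeilNegCert2.rhsQ, hN]; push_cast
    have : (c2 : ℝ) * N ≤ SemilocalMarkov.semilocalTwoConstant * N := mul_le_mul_of_nonneg_right hc2 hN0
    linarith
  have hlt : Real.log 2 / Real.sqrt 2 * weilIncrement G (Real.log 2)
      + (∫ t in Set.Ioi (0 : ℝ), weilArchDensity t * weilIncrement G t) <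
      SemilocalMarkov.semilocalTwoConstant * (∫ x, ‖G x‖ ^ 2) + 2 * ‖weilMellin G 1‖ ^ 2 :=
    lt_of_le_of_lt hlhs (hmain'.trans_le hrhs)
  exact SemilocalCertificateBridge.weilSemilocalThreshold_two_le_of_markovWitness hW hfin hlt hblt

/-- Soundness with the sharp constant (`SemilocalTwoConstantSharp.lean`): `c.check c2SharpQ = true → a*({2}) ≤ c.b`. -/
theorem weilSemilocalThreshold_two_le_of_check_sharp (c : WeilNegCert2) (h : c.check c2SharpQ = true) :
    weilSemilocalThreshold {2} ≤ (c.b : ℝ) :=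
  weilSemilocalThreshold_two_le_of_check c c2SharpQ_le h

end Summit.RiemannHypothesis.RiemannHypothesis.Theorems.SemilocalPolyWitness

end
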